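import Literature.NumberTheory.GelbartRogawski1991.DoubledBlockDiagEmbedding
import HarnessLib

/-!
# The doubled block-diagonal embedding: Siegel-parabolic bookkeeping and Weil's rational element `δ` through `σ`

Topic `NumberTheory/GelbartRogawski1991`; namespace `Literature.NumberTheory.GelbartRogawski1991.GRConstruction`; sequel of
`DoubledBlockDiagEmbedding` (`idxSplit`, `idxSplitD = σ`, `blkD : H(V₁)(𝔸) × H(V₂)(𝔸) →* H(V₁ ⊕ V₂)(𝔸)`, `toSpD_blkD`).
Proved theorems only: no definition, no named fact, no `sorry`.

* §5 the doubling blocks of `blkD (h₁, h₂)` (`blk_blkD_toBlocks₁₁ … ₂₂`, `deltaBlock_blkD`), whence **`isSiegelDelta_blkD`**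
  (`P_Δ(V₁)(𝔸) × P_Δ(V₂)(𝔸) → P_Δ(V)(𝔸)`), **`detDelta_blkD`** (`det_Δ (blkD (h₁,h₂)) = det_Δ h₁ · det_Δ h₂`), `chiDet_blkD`,
  `modDelta_blkD`, and `chiDet_mul_modDelta_blkD_inl` (`blkD (h₁, 1)` carries the same Siegel scalar `χ(det_Δ)|det_Δ|^{1/2}` as
  `h₁`) — the Siegel parabolic of the doubled space [Kudla1994, §2, Thm. 3.1], [HarrisKudlaSweet1996, §1 (1.14)–(1.15)];
* §6 **`proj_rDelta_split`** — Weil's rational element `δ` through `σ`: `σ ∘ π(r_Δ(V)) ∘ σ⁻¹ = π(r_Δ(V₁)) ⊕ π(r_Δ(V₂))` at the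
  `LinearEquiv` level, from the closed form `mapHom_deltaD_mulVec_darboux` of the `δ`-action in Darboux coordinates
  ([Li1992, p. 181]) and `gramDA_eq_diagonal`; `darboux_ratSp_fst_snd` is the Darboux read-off for Weil's rational points.

What is NOT here: the see-saw scalar `κ ≠ 0` of `(sumTransport σ (r_Δ V), r_Δ V₁, r_Δ V₂)`
(`exists_ne_zero_smul_tensorToSum_of_fst_eq_spSum` on §6), the parabolic comparison and the doubled / undoubled see-saw
conclusions built on them.

## References
* [Kudla1984] S. Kudla, *Seesaw dual reductive pairs*, Progr. Math. 46 (1984) 244–268, §1.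
* [Kudla1994] S. Kudla, *Splitting metaplectic covers of dual reductive pairs*, Israel J. Math. 87 (1994), §2, Thm. 3.1.
* [HarrisKudlaSweet1996] M. Harris, S. Kudla, W. Sweet, *Theta dichotomy for unitary groups*, J. AMS 9 (1996), §1 (1.9)–(1.15).
* [Li1992] J.-S. Li, *Non-vanishing theorems for the cohomology of certain arithmetic quotients*, J. reine angew. Math. 428
  (1992), p. 181.
* [Weil1964] A. Weil, *Sur certains groupes d'opérateurs unitaires*, Acta Math. 111 (1964), Chap. III n° 40 p. 190.
-/

set_option autoImplicit false

noncomputable section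

open scoped Classical
open scoped Matrix Kronecker
open NumberField IsDedekindDomain
open Literature.RepresentationTheory.HeisenbergGroup
open Literature.NumberTheory.Automorphic
open Literature.NumberTheory.Weil1964
open Literature.RepresentationTheory.HarrisKudlaSweet1996
open Literature.NumberTheory.GaloisRepresentations

namespace Literature.NumberTheory.GelbartRogawski1991.GRConstruction

open UnitaryDualPair

variable (L : Type) [Field L] [NumberField L] [IsCMField L]

variable {N₁ N₂ M n n₁ n₂ : ℕ} (eV : Fin (N₁ + N₂) × Fin M ≃ Fin n) (eA : Fin N₁ × Fin M ≃ Fin n₁)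
  (eB : Fin N₂ × Fin M ≃ Fin n₂)

/-! ## §5 The doubling blocks of `blkD (h₁, h₂)`; the Siegel parabolic, `det_Δ`, `χ(det_Δ)`, `|det_Δ|^{1/2}` -/

section Siegel

variable (dA : Fin N₁ → L) (hdA : ∀ i, IsCMField.complexConj L (dA i) = dA i)
  (dB : Fin N₂ → L) (hdB : ∀ i, IsCMField.complexConj L (dB i) = dB i)
  (dV : Fin (N₁ + N₂) → L) (hdV : ∀ i, IsCMField.complexConj L (dV i) = dV i)
  (hVA : ∀ i, dV (Fin.castAdd N₂ i) = dA i) (hVB : ∀ j, dV (Fin.natAdd N₁ j) = dB j)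
  (dW : Fin M → L) (hdW : ∀ i, IsCMField.complexConj L (dW i) = dW i)

local notation "𝔸L" => AdeleRing (𝓞 L) L
local notation "𝔸⁺" => AdeleRing (𝓞 (Fp L)) (Fp L)

/-- the `(1,1)` doubling block of `blkD (h₁, h₂)` is the `idxSplit⁻¹`-re-enumerated block sum of those of `h₁`, `h₂`.
[cite: Kudla1994, §2 (doubled space, Siegel parabolic)] -/
theorem blk_blkD_toBlocks₁₁ (h : HA L eA dA hdA dW hdW × HA L eB dB hdB dW hdW) :
    (blk L eV dV hdV dW hdW (blkD L eV eA eB dA hdA dB hdB dV hdV hVA hVB dW hdW h)).toBlocks₁₁ =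
      Matrix.reindex (idxSplit eV eA eB).symm (idxSplit eV eA eB).symm
        (Matrix.fromBlocks (blk L eA dA hdA dW hdW h.1).toBlocks₁₁ 0 0 (blk L eB dB hdB dW hdW h.2).toBlocks₁₁) := by
  ext k k'
  simp only [Matrix.toBlocks₁₁, Matrix.of_apply, Matrix.reindex_apply, Matrix.submatrix_apply, Equiv.symm_symm,
    coe_coe_blkD_apply, idxSplitD_apply_inl]
  generalize idxSplit eV eA eB k = z
  generalize idxSplit eV eA eB k' = z'
  rcases z with m | m <;> rcases z' with m' | m' <;>
    simp [Matrix.fromBlocks_apply₁₁, Matrix.fromBlocks_apply₁₂, Matrix.fromBlocks_apply₂₁, Matrix.fromBlocks_apply₂₂]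

/-- the `(1,2)` doubling block of `blkD (h₁, h₂)`. [cite: Kudla1994, §2 (doubled space, Siegel parabolic)] -/
theorem blk_blkD_toBlocks₁₂ (h : HA L eA dA hdA dW hdW × HA L eB dB hdB dW hdW) :
    (blk L eV dV hdV dW hdW (blkD L eV eA eB dA hdA dB hdB dV hdV hVA hVB dW hdW h)).toBlocks₁₂ =
      Matrix.reindex (idxSplit eV eA eB).symm (idxSplit eV eA eB).symm
        (Matrix.fromBlocks (blk L eA dA hdA dW hdW h.1).toBlocks₁₂ 0 0 (blk L eB dB hdB dW hdW h.2).toBlocks₁₂) := by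
  ext k k'
  simp only [Matrix.toBlocks₁₂, Matrix.of_apply, Matrix.reindex_apply, Matrix.submatrix_apply, Equiv.symm_symm,
    coe_coe_blkD_apply, idxSplitD_apply_inl, idxSplitD_apply_inr]
  generalize idxSplit eV eA eB k = z
  generalize idxSplit eV eA eB k' = z'
  rcases z with m | m <;> rcases z' with m' | m' <;>
    simp [Matrix.fromBlocks_apply₁₁, Matrix.fromBlocks_apply₁₂, Matrix.fromBlocks_apply₂₁, Matrix.fromBlocks_apply₂₂]

/-- the `(2,1)` doubling block of `blkD (h₁, h₂)`. [cite: Kudla1994, §2 (doubled space, Siegel parabolic)] -/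
theorem blk_blkD_toBlocks₂₁ (h : HA L eA dA hdA dW hdW × HA L eB dB hdB dW hdW) :
    (blk L eV dV hdV dW hdW (blkD L eV eA eB dA hdA dB hdB dV hdV hVA hVB dW hdW h)).toBlocks₂₁ =
      Matrix.reindex (idxSplit eV eA eB).symm (idxSplit eV eA eB).symm
        (Matrix.fromBlocks (blk L eA dA hdA dW hdW h.1).toBlocks₂₁ 0 0 (blk L eB dB hdB dW hdW h.2).toBlocks₂₁) := by
  ext k k'
  simp only [Matrix.toBlocks₂₁, Matrix.of_apply, Matrix.reindex_apply, Matrix.submatrix_apply, Equiv.symm_symm,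
    coe_coe_blkD_apply, idxSplitD_apply_inl, idxSplitD_apply_inr]
  generalize idxSplit eV eA eB k = z
  generalize idxSplit eV eA eB k' = z'
  rcases z with m | m <;> rcases z' with m' | m' <;>
    simp [Matrix.fromBlocks_apply₁₁, Matrix.fromBlocks_apply₁₂, Matrix.fromBlocks_apply₂₁, Matrix.fromBlocks_apply₂₂]

/-- the `(2,2)` doubling block of `blkD (h₁, h₂)`. [cite: Kudla1994, §2 (doubled space, Siegel parabolic)] -/
theorem blk_blkD_toBlocks₂₂ (h : HA L eA dA hdA dW hdW × HA L eB dB hdB dW hdW) :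
    (blk L eV dV hdV dW hdW (blkD L eV eA eB dA hdA dB hdB dV hdV hVA hVB dW hdW h)).toBlocks₂₂ =
      Matrix.reindex (idxSplit eV eA eB).symm (idxSplit eV eA eB).symm
        (Matrix.fromBlocks (blk L eA dA hdA dW hdW h.1).toBlocks₂₂ 0 0 (blk L eB dB hdB dW hdW h.2).toBlocks₂₂) := by
  ext k k'
  simp only [Matrix.toBlocks₂₂, Matrix.of_apply, Matrix.reindex_apply, Matrix.submatrix_apply, Equiv.symm_symm,
    coe_coe_blkD_apply, idxSplitD_apply_inr]
  generalize idxSplit eV eA eB k = z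
  generalize idxSplit eV eA eB k' = z'
  rcases z with m | m <;> rcases z' with m' | m' <;>
    simp [Matrix.fromBlocks_apply₁₁, Matrix.fromBlocks_apply₁₂, Matrix.fromBlocks_apply₂₁, Matrix.fromBlocks_apply₂₂]

/-- **`h|_Δ` of `blkD (h₁, h₂)` is the re-enumerated block sum of `h₁|_Δ`, `h₂|_Δ`** (`deltaBlock = blk₁₁ + blk₁₂`).
[cite: Kudla1994, §2 (doubled space, Siegel parabolic)] -/
theorem deltaBlock_blkD (h : HA L eA dA hdA dW hdW × HA L eB dB hdB dW hdW) :
    deltaBlock L eV dV hdV dW hdW (blkD L eV eA eB dA hdA dB hdB dV hdV hVA hVB dW hdW h) =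
      Matrix.reindex (idxSplit eV eA eB).symm (idxSplit eV eA eB).symm
        (Matrix.fromBlocks (deltaBlock L eA dA hdA dW hdW h.1) 0 0 (deltaBlock L eB dB hdB dW hdW h.2)) := by
  have hsub : ∀ (A B : Matrix (Fin n₁ ⊕ Fin n₂) (Fin n₁ ⊕ Fin n₂) 𝔸L),
      A.submatrix (idxSplit eV eA eB).symm.symm (idxSplit eV eA eB).symm.symm +
        B.submatrix (idxSplit eV eA eB).symm.symm (idxSplit eV eA eB).symm.symm =
      (A + B).submatrix (idxSplit eV eA eB).symm.symm (idxSplit eV eA eB).symm.symm := fun _ _ => rfl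
  unfold deltaBlock
  rw [blk_blkD_toBlocks₁₁, blk_blkD_toBlocks₁₂, Matrix.reindex_apply, Matrix.reindex_apply, Matrix.reindex_apply, hsub,
    Matrix.fromBlocks_add, add_zero, add_zero]

/-- **`P_Δ(V₁)(𝔸) × P_Δ(V₂)(𝔸) → P_Δ(V)(𝔸)`**: `blkD` of two Siegel elements is Siegel. [cite: Kudla1994, §2 (doubled space, Siegel parabolic)] -/
theorem isSiegelDelta_blkD {p : HA L eA dA hdA dW hdW} {q : HA L eB dB hdB dW hdW}
    (hp : IsSiegelDelta L eA dA hdA dW hdW p) (hq : IsSiegelDelta L eB dB hdB dW hdW q) :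
    IsSiegelDelta L eV dV hdV dW hdW (blkD L eV eA eB dA hdA dB hdB dV hdV hVA hVB dW hdW (p, q)) := by
  have hsub : ∀ (A B : Matrix (Fin n₁ ⊕ Fin n₂) (Fin n₁ ⊕ Fin n₂) 𝔸L),
      A.submatrix (idxSplit eV eA eB).symm.symm (idxSplit eV eA eB).symm.symm +
        B.submatrix (idxSplit eV eA eB).symm.symm (idxSplit eV eA eB).symm.symm =
      (A + B).submatrix (idxSplit eV eA eB).symm.symm (idxSplit eV eA eB).symm.symm := fun _ _ => rfl
  unfold IsSiegelDelta at hp hq ⊢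
  rw [blk_blkD_toBlocks₁₁, blk_blkD_toBlocks₁₂, blk_blkD_toBlocks₂₁, blk_blkD_toBlocks₂₂, Matrix.reindex_apply,
    Matrix.reindex_apply, Matrix.reindex_apply, Matrix.reindex_apply, hsub, hsub, Matrix.fromBlocks_add, Matrix.fromBlocks_add,
    add_zero, hp, hq]

/-- **`det_Δ (blkD (h₁, h₂)) = det_Δ h₁ · det_Δ h₂`.** [cite: Kudla1994, §2 (doubled space, Siegel parabolic), Thm. 3.1] -/
theorem detDelta_blkD (h : HA L eA dA hdA dW hdW × HA L eB dB hdB dW hdW) :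
    detDelta L eV dV hdV dW hdW (blkD L eV eA eB dA hdA dB hdB dV hdV hVA hVB dW hdW h) =
      detDelta L eA dA hdA dW hdW h.1 * detDelta L eB dB hdB dW hdW h.2 := by
  unfold detDelta
  rw [deltaBlock_blkD, Matrix.det_reindex_self, Matrix.det_fromBlocks_zero₂₁]

/-- `det_Δ (blkD (h₁, h₂))` is a unit when `det_Δ h₁`, `det_Δ h₂` are. [cite: Kudla1994, §2 (doubled space, Siegel parabolic), Thm. 3.1] -/
theorem isUnit_detDelta_blkD {h : HA L eA dA hdA dW hdW × HA L eB dB hdB dW hdW}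
    (h₁ : IsUnit (detDelta L eA dA hdA dW hdW h.1)) (h₂ : IsUnit (detDelta L eB dB hdB dW hdW h.2)) :
    IsUnit (detDelta L eV dV hdV dW hdW (blkD L eV eA eB dA hdA dB hdB dV hdV hVA hVB dW hdW h)) := by
  rw [detDelta_blkD]
  exact h₁.mul h₂

/-- **`χ(det_Δ (blkD (h₁, h₂))) = χ(det_Δ h₁) · χ(det_Δ h₂)`** (units). [cite: Kudla1994, §2 (doubled space, Siegel parabolic), Thm. 3.1] -/
theorem chiDet_blkD (χ : HeckeCharacter L) {h : HA L eA dA hdA dW hdW × HA L eB dB hdB dW hdW}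
    (h₁ : IsUnit (detDelta L eA dA hdA dW hdW h.1)) (h₂ : IsUnit (detDelta L eB dB hdB dW hdW h.2)) :
    chiDet L eV dV hdV dW hdW χ (blkD L eV eA eB dA hdA dB hdB dV hdV hVA hVB dW hdW h) =
      chiDet L eA dA hdA dW hdW χ h.1 * chiDet L eB dB hdB dW hdW χ h.2 := by
  have hu := isUnit_detDelta_blkD L eV eA eB dA hdA dB hdB dV hdV hVA hVB dW hdW h₁ h₂
  have hunit : hu.unit = h₁.unit * h₂.unit :=
    Units.ext (by rw [Units.val_mul, IsUnit.unit_spec, IsUnit.unit_spec, IsUnit.unit_spec, detDelta_blkD])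
  unfold chiDet
  rw [dif_pos hu, dif_pos h₁, dif_pos h₂, ← map_mul, hunit]

/-- **`|det_Δ (blkD (h₁, h₂))|^{1/2} = |det_Δ h₁|^{1/2} · |det_Δ h₂|^{1/2}`** (units).
[cite: Kudla1994, §2 (doubled space, Siegel parabolic), Thm. 3.1] -/
theorem modDelta_blkD {h : HA L eA dA hdA dW hdW × HA L eB dB hdB dW hdW}
    (h₁ : IsUnit (detDelta L eA dA hdA dW hdW h.1)) (h₂ : IsUnit (detDelta L eB dB hdB dW hdW h.2)) :
    modDelta L eV dV hdV dW hdW (blkD L eV eA eB dA hdA dB hdB dV hdV hVA hVB dW hdW h) =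
      modDelta L eA dA hdA dW hdW h.1 * modDelta L eB dB hdB dW hdW h.2 := by
  have hu := isUnit_detDelta_blkD L eV eA eB dA hdA dB hdB dV hdV hVA hVB dW hdW h₁ h₂
  have hunit : hu.unit = h₁.unit * h₂.unit :=
    Units.ext (by rw [Units.val_mul, IsUnit.unit_spec, IsUnit.unit_spec, IsUnit.unit_spec, detDelta_blkD])
  unfold modDelta
  rw [dif_pos hu, dif_pos h₁, dif_pos h₂, hunit, ← coe_ideleNorm, ← coe_ideleNorm, ← coe_ideleNorm, map_mul, NNReal.coe_mul,
    Real.sqrt_mul (NNReal.coe_nonneg _)]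

/-- `blkD (h₁, 1)` of a Siegel `h₁` with unit `det_Δ` carries the SAME prescribed scalar `χ(det_Δ) |det_Δ|^{1/2}` as `h₁`.
[cite: Kudla1994, §2 (doubled space, Siegel parabolic), Thm. 3.1] [cite: HarrisKudlaSweet1996, §1 (1.14)–(1.15)] -/
theorem chiDet_mul_modDelta_blkD_inl (χ : HeckeCharacter L) {p : HA L eA dA hdA dW hdW}
    (hp : IsUnit (detDelta L eA dA hdA dW hdW p)) :
    ((chiDet L eV dV hdV dW hdW χ (blkD L eV eA eB dA hdA dB hdB dV hdV hVA hVB dW hdW (p, 1)) : ℂˣ) : ℂ) *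
        (modDelta L eV dV hdV dW hdW (blkD L eV eA eB dA hdA dB hdB dV hdV hVA hVB dW hdW (p, 1)) : ℂ) =
      ((chiDet L eA dA hdA dW hdW χ p : ℂˣ) : ℂ) * (modDelta L eA dA hdA dW hdW p : ℂ) := by
  have h1 : IsUnit (detDelta L eB dB hdB dW hdW (1 : HA L eB dB hdB dW hdW)) := by
    rw [detDelta_one']; exact isUnit_one
  rw [chiDet_blkD L eV eA eB dA hdA dB hdB dV hdV hVA hVB dW hdW χ (h := (p, 1)) hp h1,
    modDelta_blkD L eV eA eB dA hdA dB hdB dV hdV hVA hVB dW hdW (h := (p, 1)) hp h1, chiDet_one', modDelta_one',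
    mul_one, mul_one]

end Siegel

/-! ## §6 Weil's rational element `δ` through `σ`: `r_Δ(V) ↔ r_Δ(V₁) ⊕ r_Δ(V₂)` at the symplectic level -/

section Delta

open Literature.RepresentationTheory.HeisenbergGroup.SymplecticMatrix

local notation "𝔸⁺" => AdeleRing (𝓞 (Fp L)) (Fp L)

variable {N : ℕ} (e : Fin N × Fin M ≃ Fin n) (d : Fin N → L) (hd : ∀ i, IsCMField.complexConj L (d i) = d i)
  (dW : Fin M → L) (hdW : ∀ i, IsCMField.complexConj L (dW i) = dW i)

/-- `T^𝔻 ⊗ 1` is diagonal with entries `(t₀ ⊕ (−t₀)) ∘ e₂⁻¹` read in `𝔸_{L⁺}`. [cite: HarrisKudlaSweet1996, §1 (1.9)] -/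
theorem gramDA_eq_diagonal :
    gramDA L e d hd dW hdW = Matrix.diagonal fun k => algebraMap (Fp L) 𝔸⁺
      (Sum.elim (cmGramEntry L e d hd dW hdW) (-cmGramEntry L e d hd dW hdW) ((finSumFinEquiv (m := n) (n := n)).symm k)) := by
  unfold gramDA
  rw [gramD_eq_diagonal, Matrix.diagonal_map (map_zero _)]

/-- **the action of Weil's `δ` in Darboux coordinates, in closed form**: for `u = (x, T^𝔻 y)`,
`δ (x₁, x₂; y₁, y₂) = (x₁ − x₂, t (y₁ − y₂); t y₁, −x₂)` copy by copy (`t = t₀ ⊗ 1` the Gram entries of `𝕎`).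
[cite: Li1992, p. 181] [cite: Kudla1994, §2 (doubled space, Siegel parabolic)] -/
theorem mapHom_deltaD_mulVec_darboux (x y : Fin (n + n) → 𝔸⁺) :
    ((mapHom (algebraMap (Fp L) 𝔸⁺) (deltaD L) : Matrix.symplecticGroup (Fin (n + n)) 𝔸⁺) :
        Matrix (Fin (n + n) ⊕ Fin (n + n)) (Fin (n + n) ⊕ Fin (n + n)) 𝔸⁺) *ᵥ
        Sum.elim x (gramDA L e d hd dW hdW *ᵥ y) =
      Sum.elim
        (fun K => Sum.elim (fun k => x (finSumFinEquiv (Sum.inl k)) - x (finSumFinEquiv (Sum.inr k)))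
          (fun k => algebraMap (Fp L) 𝔸⁺ (cmGramEntry L e d hd dW hdW k) * y (finSumFinEquiv (Sum.inl k)) -
            algebraMap (Fp L) 𝔸⁺ (cmGramEntry L e d hd dW hdW k) * y (finSumFinEquiv (Sum.inr k)))
          ((finSumFinEquiv (m := n) (n := n)).symm K))
        (fun K => Sum.elim (fun k => algebraMap (Fp L) 𝔸⁺ (cmGramEntry L e d hd dW hdW k) * y (finSumFinEquiv (Sum.inl k)))
          (fun k => -x (finSumFinEquiv (Sum.inr k))) ((finSumFinEquiv (m := n) (n := n)).symm K)) := by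
  rw [coe_mapHom_deltaD, Matrix.reindex_apply, Matrix.submatrix_mulVec_equiv, Equiv.symm_symm]
  have hu : Sum.elim x (gramDA L e d hd dW hdW *ᵥ y) ∘ ⇑((finSumFinEquiv (m := n) (n := n)).sumCongr
      (finSumFinEquiv (m := n) (n := n))) =
      Sum.elim (Sum.elim (x ∘ ⇑finSumFinEquiv ∘ Sum.inl) (x ∘ ⇑finSumFinEquiv ∘ Sum.inr))
        (Sum.elim ((gramDA L e d hd dW hdW *ᵥ y) ∘ ⇑finSumFinEquiv ∘ Sum.inl)
          ((gramDA L e d hd dW hdW *ᵥ y) ∘ ⇑finSumFinEquiv ∘ Sum.inr)) := by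
    funext J; rcases J with (k | k) | (k | k) <;> rfl
  rw [hu, deltaDiagMatrix, Matrix.fromBlocks_mulVec, Matrix.fromBlocks_mulVec, Matrix.fromBlocks_mulVec,
    Matrix.fromBlocks_mulVec, Matrix.fromBlocks_mulVec]
  simp only [Matrix.one_mulVec, Matrix.neg_mulVec, Matrix.zero_mulVec, add_zero, zero_add]
  funext J
  rcases J with K | K
  · simp only [Function.comp_apply, Sum.elim_inl, Equiv.sumCongr_symm, Equiv.sumCongr_apply, Sum.map_inl]
    rcases (finSumFinEquiv (m := n) (n := n)).symm K with k | k <;>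
      simp only [gramDA_eq_diagonal, Matrix.mulVec_diagonal, Equiv.symm_apply_apply, Sum.elim_inl, Sum.elim_inr,
        Pi.add_apply, Pi.neg_apply, Pi.zero_apply, Function.comp_apply, map_neg, neg_mul, add_zero, zero_add,
        sub_eq_add_neg]
  · simp only [Function.comp_apply, Sum.elim_inr, Equiv.sumCongr_symm, Equiv.sumCongr_apply, Sum.map_inr]
    rcases (finSumFinEquiv (m := n) (n := n)).symm K with k | k <;>
      simp only [gramDA_eq_diagonal, Matrix.mulVec_diagonal, Equiv.symm_apply_apply, Sum.elim_inl, Sum.elim_inr,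
        Pi.add_apply, Pi.neg_apply, Pi.zero_apply, Function.comp_apply, add_zero, zero_add]

variable (dA : Fin N₁ → L) (hdA : ∀ i, IsCMField.complexConj L (dA i) = dA i) (hdA0 : ∀ i, dA i ≠ 0)
  (dB : Fin N₂ → L) (hdB : ∀ i, IsCMField.complexConj L (dB i) = dB i) (hdB0 : ∀ i, dB i ≠ 0)
  (dV : Fin (N₁ + N₂) → L) (hdV : ∀ i, IsCMField.complexConj L (dV i) = dV i) (hdV0 : ∀ i, dV i ≠ 0)
  (hVA : ∀ i, dV (Fin.castAdd N₂ i) = dA i) (hVB : ∀ j, dV (Fin.natAdd N₁ j) = dB j)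
  (hdW0 : ∀ i, dW i ≠ 0)

omit [IsCMField L] in
/-- Darboux read-off for Weil's rational points: for `w = P⁻¹(γ P v)`, `w.1 = (γ P v)|₁` and `T w.2 = (γ P v)|₂`. [cite: Weil1964, Chap. III n° 40 p. 190] -/
theorem darboux_ratSp_fst_snd {k : ℕ} (T : Matrix (Fin k) (Fin k) 𝔸⁺) (hT : IsUnit T.det)
    (γ : Matrix.symplecticGroup (Fin k) (Fp L)) (v : (Fin k → 𝔸⁺) × (Fin k → 𝔸⁺)) :
    (((ratSp (Fp L) T hT γ : symplecticGroup (polar (adelicForm (Fp L) (Fin k) T))) :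
        ((Fin k → 𝔸⁺) × (Fin k → 𝔸⁺)) ≃ₗ[𝔸⁺] ((Fin k → 𝔸⁺) × (Fin k → 𝔸⁺))) v).1 =
        (((mapHom (algebraMap (Fp L) 𝔸⁺) γ : Matrix.symplecticGroup (Fin k) 𝔸⁺) :
          Matrix (Fin k ⊕ Fin k) (Fin k ⊕ Fin k) 𝔸⁺) *ᵥ darboux T hT v) ∘ Sum.inl ∧
      T *ᵥ (((ratSp (Fp L) T hT γ : symplecticGroup (polar (adelicForm (Fp L) (Fin k) T))) :
        ((Fin k → 𝔸⁺) × (Fin k → 𝔸⁺)) ≃ₗ[𝔸⁺] ((Fin k → 𝔸⁺) × (Fin k → 𝔸⁺))) v).2 =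
        (((mapHom (algebraMap (Fp L) 𝔸⁺) γ : Matrix.symplecticGroup (Fin k) 𝔸⁺) :
          Matrix (Fin k ⊕ Fin k) (Fin k ⊕ Fin k) 𝔸⁺) *ᵥ darboux T hT v) ∘ Sum.inr := by
  have h : darboux T hT (((ratSp (Fp L) T hT γ : symplecticGroup (polar (adelicForm (Fp L) (Fin k) T))) :
      ((Fin k → 𝔸⁺) × (Fin k → 𝔸⁺)) ≃ₗ[𝔸⁺] ((Fin k → 𝔸⁺) × (Fin k → 𝔸⁺))) v) =
      ((mapHom (algebraMap (Fp L) 𝔸⁺) γ : Matrix.symplecticGroup (Fin k) 𝔸⁺) :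
        Matrix (Fin k ⊕ Fin k) (Fin k ⊕ Fin k) 𝔸⁺) *ᵥ darboux T hT v := by
    change darboux T hT (((transportSp T hT (mapHom (algebraMap (Fp L) 𝔸⁺) γ) :
      symplecticGroup (polar (Matrix.toLinearMap₂' 𝔸⁺ T))) : ((Fin k → 𝔸⁺) × (Fin k → 𝔸⁺)) ≃ₗ[𝔸⁺]
        ((Fin k → 𝔸⁺) × (Fin k → 𝔸⁺))) v) = _
    rw [coe_transportSp_apply, LinearEquiv.apply_symm_apply]
  rw [darboux_apply] at h
  exact ⟨by rw [← h, Sum.elim_comp_inl], by rw [← h, Sum.elim_comp_inr]⟩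

set_option maxHeartbeats 400000 in
-- (statement elaboration of the three `projD (rDelta …)` telescopes measures in (160 k, 200 k]: one 2× line, B30)
include hVA hVB hdA0 hdB0 hdW0 in
/-- **`δ` THROUGH `σ`: `σ ∘ π(r_Δ(V)) ∘ σ⁻¹ = π(r_Δ(V₁)) ⊕ π(r_Δ(V₂))`** at the `LinearEquiv` level (the see-saw compatibility of
Weil's rational elements `r_F^𝔻(δ)` of the three doubled spaces, whence the see-saw scalar of
`(sumTransport σ (r_Δ V), r_Δ V₁, r_Δ V₂)` by ★ `exists_ne_zero_smul_tensorToSum_of_fst_eq_spSum`).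
[cite: Li1992, p. 181] [cite: Kudla1984, §1] [cite: Kudla1994, §2 (doubled space, Siegel parabolic)] -/
theorem proj_rDelta_split :
    (UnitaryGroup.spReindex (idxSplitD eV eA eB) (gramDA L eV dV hdV dW hdW)
        (projD L eV dV hdV dW hdW (rDelta L eV dV hdV hdV0 dW hdW hdW0))).1 =
      (UnitaryGroup.spSum (gramDA L eA dA hdA dW hdW) (gramDA L eB dB hdB dW hdW)
        (projD L eA dA hdA dW hdW (rDelta L eA dA hdA hdA0 dW hdW hdW0),
          projD L eB dB hdB dW hdW (rDelta L eB dB hdB hdB0 dW hdW hdW0))).1 := by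
  have hpV : projD L eV dV hdV dW hdW (rDelta L eV dV hdV hdV0 dW hdW hdW0) =
      ratSp (Fp L) (gramDA L eV dV hdV dW hdW) (isUnit_det_gramDA L eV dV hdV hdV0 dW hdW hdW0) (deltaD L) :=
    proj_ratThetaLiftCont (Fp L) _ _ (deltaD L)
  have hpA : projD L eA dA hdA dW hdW (rDelta L eA dA hdA hdA0 dW hdW hdW0) =
      ratSp (Fp L) (gramDA L eA dA hdA dW hdW) (isUnit_det_gramDA L eA dA hdA hdA0 dW hdW hdW0) (deltaD L) :=
    proj_ratThetaLiftCont (Fp L) _ _ (deltaD L)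
  have hpB : projD L eB dB hdB dW hdW (rDelta L eB dB hdB hdB0 dW hdW hdW0) =
      ratSp (Fp L) (gramDA L eB dB hdB dW hdW) (isUnit_det_gramDA L eB dB hdB hdB0 dW hdW hdW0) (deltaD L) :=
    proj_ratThetaLiftCont (Fp L) _ _ (deltaD L)
  have hT' : IsUnit (Matrix.fromBlocks (gramDA L eA dA hdA dW hdW) 0 0 (gramDA L eB dB hdB dW hdW)).det := by
    rw [Matrix.det_fromBlocks_zero₂₁]
    exact (isUnit_det_gramDA L eA dA hdA hdA0 dW hdW hdW0).mul (isUnit_det_gramDA L eB dB hdB hdB0 dW hdW hdW0)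
  have hTsplit : Matrix.reindex (idxSplitD eV eA eB) (idxSplitD eV eA eB) (gramDA L eV dV hdV dW hdW) =
      Matrix.fromBlocks (gramDA L eA dA hdA dW hdW) 0 0 (gramDA L eB dB hdB dW hdW) :=
    reindex_idxSplitD_gramDA L eV eA eB dA hdA dB hdB dV hdV hVA hVB dW hdW
  -- `T' (w ∘ σ⁻¹) = (T_V w) ∘ σ⁻¹`
  have hmul : ∀ w : Fin (n + n) → 𝔸⁺,
      Matrix.fromBlocks (gramDA L eA dA hdA dW hdW) 0 0 (gramDA L eB dB hdB dW hdW) *ᵥ (w ∘ ⇑(idxSplitD eV eA eB).symm) =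
        (gramDA L eV dV hdV dW hdW *ᵥ w) ∘ ⇑(idxSplitD eV eA eB).symm := fun w => by
    rw [← hTsplit, Matrix.reindex_apply, Matrix.submatrix_mulVec_equiv]
    congr 2
    funext i; simp only [Function.comp_apply, Equiv.symm_symm, Equiv.symm_apply_apply]
  -- generalise the three symplectic elements (rewriting `projD (rDelta)` inside the big goal hits the isDefEq cliff)
  suffices key : ∀ (gV : symplecticGroup (polar (adelicForm (Fp L) (Fin (n + n)) (gramDA L eV dV hdV dW hdW))))
      (gA : symplecticGroup (polar (adelicForm (Fp L) (Fin (n₁ + n₁)) (gramDA L eA dA hdA dW hdW))))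
      (gB : symplecticGroup (polar (adelicForm (Fp L) (Fin (n₂ + n₂)) (gramDA L eB dB hdB dW hdW)))),
      gV = ratSp (Fp L) (gramDA L eV dV hdV dW hdW) (isUnit_det_gramDA L eV dV hdV hdV0 dW hdW hdW0) (deltaD L) →
      gA = ratSp (Fp L) (gramDA L eA dA hdA dW hdW) (isUnit_det_gramDA L eA dA hdA hdA0 dW hdW hdW0) (deltaD L) →
      gB = ratSp (Fp L) (gramDA L eB dB hdB dW hdW) (isUnit_det_gramDA L eB dB hdB hdB0 dW hdW hdW0) (deltaD L) →
      (UnitaryGroup.spReindex (idxSplitD eV eA eB) (gramDA L eV dV hdV dW hdW) gV).1 =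
        (UnitaryGroup.spSum (gramDA L eA dA hdA dW hdW) (gramDA L eB dB hdB dW hdW) (gA, gB)).1 from
    key _ _ _ hpV hpA hpB
  rintro gV gA gB hgV hgA hgB
  refine LinearEquiv.ext fun v => ?_
  change UnitaryGroup.reindexW 𝔸⁺ (idxSplitD eV eA eB)
      ((gV : ((Fin (n + n) → 𝔸⁺) × (Fin (n + n) → 𝔸⁺)) ≃ₗ[𝔸⁺] ((Fin (n + n) → 𝔸⁺) × (Fin (n + n) → 𝔸⁺)))
        ((UnitaryGroup.reindexW 𝔸⁺ (idxSplitD eV eA eB)).symm v)) =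
    UnitaryGroup.spSumEquiv
      (gA : ((Fin (n₁ + n₁) → 𝔸⁺) × (Fin (n₁ + n₁) → 𝔸⁺)) ≃ₗ[𝔸⁺] ((Fin (n₁ + n₁) → 𝔸⁺) × (Fin (n₁ + n₁) → 𝔸⁺)))
      (gB : ((Fin (n₂ + n₂) → 𝔸⁺) × (Fin (n₂ + n₂) → 𝔸⁺)) ≃ₗ[𝔸⁺] ((Fin (n₂ + n₂) → 𝔸⁺) × (Fin (n₂ + n₂) → 𝔸⁺))) v
  obtain ⟨x, y⟩ := v
  rw [UnitaryGroup.reindexW_symm_apply]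
  apply (darboux (Matrix.fromBlocks (gramDA L eA dA hdA dW hdW) 0 0 (gramDA L eB dB hdB dW hdW)) hT').injective
  rw [UnitaryGroup.spSumEquiv_apply, darboux_apply, darboux_apply, UnitaryGroup.reindexW_apply]
  dsimp only
  -- the three Darboux read-offs
  obtain ⟨hV1, hV2⟩ := darboux_ratSp_fst_snd L (gramDA L eV dV hdV dW hdW) (isUnit_det_gramDA L eV dV hdV hdV0 dW hdW hdW0)
    (deltaD L) (x ∘ ⇑(idxSplitD eV eA eB), y ∘ ⇑(idxSplitD eV eA eB))
  obtain ⟨hA1, hA2⟩ := darboux_ratSp_fst_snd L (gramDA L eA dA hdA dW hdW) (isUnit_det_gramDA L eA dA hdA hdA0 dW hdW hdW0)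
    (deltaD L) (x ∘ Sum.inl, y ∘ Sum.inl)
  obtain ⟨hB1, hB2⟩ := darboux_ratSp_fst_snd L (gramDA L eB dB hdB dW hdW) (isUnit_det_gramDA L eB dB hdB hdB0 dW hdW hdW0)
    (deltaD L) (x ∘ Sum.inr, y ∘ Sum.inr)
  rw [darboux_apply, mapHom_deltaD_mulVec_darboux] at hV1 hV2 hA1 hA2 hB1 hB2
  rw [← hgV] at hV1 hV2
  rw [← hgA] at hA1 hA2
  rw [← hgB] at hB1 hB2
  rw [hV1, hA1, hB1, hmul, hV2, Matrix.fromBlocks_mulVec]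
  simp only [Sum.elim_comp_inl, Sum.elim_comp_inr, Matrix.zero_mulVec, add_zero, zero_add]
  rw [hA2, hB2]
  simp only [Sum.elim_comp_inr]
  funext J
  rcases J with K | K <;> rcases K with K | K
  · obtain ⟨z, rfl⟩ := (finSumFinEquiv (m := n₁) (n := n₁)).surjective K
    rcases z with m | m
    · simp only [Sum.elim_inl, Function.comp_apply, idxSplitD_symm_inl_inl, Equiv.symm_apply_apply, idxSplitD_apply_inl,
        idxSplitD_apply_inr, Equiv.apply_symm_apply, Sum.map_inl]
    · simp only [Sum.elim_inl, Function.comp_apply, idxSplitD_symm_inl_inr, Equiv.symm_apply_apply, idxSplitD_apply_inl,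
        idxSplitD_apply_inr, Equiv.apply_symm_apply, Sum.map_inl, Sum.elim_inr,
        cmGramEntry_idxSplit_symm_inl L eV eA eB dA hdA dV hdV hVA dW hdW]
  · obtain ⟨z, rfl⟩ := (finSumFinEquiv (m := n₂) (n := n₂)).surjective K
    rcases z with m | m
    · simp only [Sum.elim_inl, Sum.elim_inr, Function.comp_apply, idxSplitD_symm_inr_inl, Equiv.symm_apply_apply,
        idxSplitD_apply_inl, idxSplitD_apply_inr, Equiv.apply_symm_apply, Sum.map_inr]
    · simp only [Sum.elim_inl, Sum.elim_inr, Function.comp_apply, idxSplitD_symm_inr_inr, Equiv.symm_apply_apply,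
        idxSplitD_apply_inl, idxSplitD_apply_inr, Equiv.apply_symm_apply, Sum.map_inr,
        cmGramEntry_idxSplit_symm_inr L eV eA eB dB hdB dV hdV hVB dW hdW]
  · obtain ⟨z, rfl⟩ := (finSumFinEquiv (m := n₁) (n := n₁)).surjective K
    rcases z with m | m
    · simp only [Sum.elim_inl, Sum.elim_inr, Function.comp_apply, idxSplitD_symm_inl_inl, Equiv.symm_apply_apply,
        idxSplitD_apply_inl, idxSplitD_apply_inr, Equiv.apply_symm_apply, Sum.map_inl,
        cmGramEntry_idxSplit_symm_inl L eV eA eB dA hdA dV hdV hVA dW hdW]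
    · simp only [Sum.elim_inl, Sum.elim_inr, Function.comp_apply, idxSplitD_symm_inl_inr, Equiv.symm_apply_apply,
        idxSplitD_apply_inl, idxSplitD_apply_inr, Equiv.apply_symm_apply, Sum.map_inl]
  · obtain ⟨z, rfl⟩ := (finSumFinEquiv (m := n₂) (n := n₂)).surjective K
    rcases z with m | m
    · simp only [Sum.elim_inl, Sum.elim_inr, Function.comp_apply, idxSplitD_symm_inr_inl, Equiv.symm_apply_apply,
        idxSplitD_apply_inl, idxSplitD_apply_inr, Equiv.apply_symm_apply, Sum.map_inr,
        cmGramEntry_idxSplit_symm_inr L eV eA eB dB hdB dV hdV hVB dW hdW]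
    · simp only [Sum.elim_inr, Function.comp_apply, idxSplitD_symm_inr_inr, Equiv.symm_apply_apply,
        idxSplitD_apply_inl, idxSplitD_apply_inr, Equiv.apply_symm_apply, Sum.map_inr]

end Delta

end Literature.NumberTheory.GelbartRogawski1991.GRConstruction

end
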